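import Summits.BirchSwinnertonDyer.BirchSwinnertonDyer.Theorems.GoldfeldK12AdditiveTwoBaseChange
import HarnessLib

set_option linter.dupNamespace false
set_option autoImplicit false

/-!
# The parent crux K12₂′ by quadratic base change: the rank-one `2`-converse for ALL `ℚ(√−7)`-curves
# ⟺ the `K`-level `2`-converse for `X₀(49)` over ALL imaginary quadratic fields; its printed cell =
# odd discriminants, its open cell = even discriminants

Cell `bsd-goldfeld`, prover seat `s1p-c201`, third file (companion of `GoldfeldK12AdditiveTwoBaseChange`,
p418192). Items: the parent crux `Theses.GoldfeldAllTwistsTwoConverse.RankOneTwoConverseCMSevenAtAnyTwo`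
(K12₂′, stmt-BirchSwinnertonDyer-19349: for every elliptic `W/ℚ` with `j ∈ {−3375, 16581375}`, any model,
any reduction at `2`, `corank_{ℤ₂} Sel_{2^∞}(W/ℚ) = 1 ⟹ ord_{s=1} L(W, s) = 1`), its additive cell K12₂″
(stmt-…-20044) and its good cell (BCST Thm. A at `p = 2`, stmt-…-20045). PROOF-ONLY file (no definition,
no named fact, no instance): the `K`-level statements appear inline.

Granted analytic continuation (`hmod : hasEntireLFunction_rat`) and Coates–Li–Tian–Zhai Thm. 1.2 at
`R = 1` (`h12`: `L(X₀(49), 1) ≠ 0`, rank `0`, `Ш` finite), with `E₀ = cm7 = X₀(49)`: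

* `rankOneTwoConverseCMSevenAtAnyTwo_iff_kLevelAllDiscr`: **K12₂′ ⟺ (∀ imaginary quadratic `K`,
  `corank_{ℤ₂} Sel_{2^∞}(E₀/K) = 1 ⟹ ord_{s=1} L(E₀/K, s) = 1)`** — the parent crux is a statement about
  ONE good-ordinary curve over all imaginary quadratic fields (no reduction-type bookkeeping at all:
  K12₂′ is model-free, so neither the local analysis at `2` nor Tate's algorithm enters);
* `goodCell_iff_kLevelOddDiscr`: the GOOD cell (`W` minimal, `j = −3375`, good at `2`) ⟺ the same
  `K`-level statement over the `K` of ODD discriminant (`2` unramified in `K`); with file 1's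
  `rankOneTwoConverseCMSevenAdditiveTwo_iff_kLevelEvenDiscr` (additive cell ⟺ EVEN discriminants) and
  `kLevelAllDiscr_iff_oddDiscr_and_evenDiscr` this splits the parent along `d_K mod 4` exactly as the route
  splits it along the reduction type at `2`;
* `kLevelOddDiscr_of_thmA`: Burungale–Castella–Skinner–Tian Thm. A (the tree's cite-tagged fact, item 20045)
  ⟹ the odd-discriminant leaf; hence `rankOneTwoConverseCMSevenAtAnyTwo_iff_kLevelEvenDiscr_of_thmA`:
  granted BCST Thm. A, **K12₂′ ⟺ `X049KLevelTwoConverseEvenDiscr`** (file 1's leaf).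

READING. What the printed rank-one `2`-converse (BCST Thm. A / Burungale–Skinner Thm. 10.3 at `p = 2`)
covers is, in `K`-level currency, exactly "`2` UNRAMIFIED in `K`"; what is open (K12₂″) is exactly
"`2` RAMIFIED in `K`" — for the single curve `X₀(49)`.

References: Burungale–Castella–Skinner–Tian, Ann. Math. Qué. 46 (2022) Thm. A, Rem. D
[BurungaleCastellaSkinnerTian2022]; Coates–Li–Tian–Zhai, PLMS 110 (2015) Thm. 1.2 [CoatesLiTianZhai2015];
T. Dokchitser, parity notes (2013) §4 [Dokchitser2013ParityNotes]; Barrios et al., Res. Number Theory 11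
(2025) Thm. 5.1 [BarriosEtAl2025]; Silverman, *AEC* X.5, VIII.8.3 [SilvermanAEC2009]; Gross–Zagier,
Invent. Math. 84 (1986) I.§7 [GrossZagier1986].
-/

noncomputable section

open scoped Classical

open WeierstrassCurve Literature.NumberTheory Literature.NumberTheory.EllipticCurves

namespace Summit.BirchSwinnertonDyer.BirchSwinnertonDyer.Theorems.GoldfeldGoodTwists

/-! ## §1 `ℚ(√n)` for a negative squarefree `n`, and `E₀^{(d_K)} ≅ E₀^{(n)}` -/

/-- For a negative squarefree integer `n` there is an imaginary quadratic field `K = ℚ(√n)`, of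
discriminant `n` (`n ≡ 1 (mod 4)`) or `4n` (`n ≡ 2, 3 (mod 4)`), and `E₀^{(d_K)}` is `ℚ`-isomorphic to
`E₀^{(n)}` (`E₀^{(4n)} = ⟨2⁻¹,0,0,0⟩ • E₀^{(n)}`). [cite: SilvermanAEC2009, X.5 Prop. 5.4] -/
theorem exists_imaginaryQuadratic_quadraticTwist_cm7_eq_smul {n : ℤ} (hsq : Squarefree n) (hneg : n < 0) :
    ∃ (K : Type) (_ : Field K) (_ : NumberField K), IsImaginaryQuadratic K ∧
      (NumberField.discr K = n ∨ NumberField.discr K = 4 * n) ∧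
      ∃ C : VariableChange ℚ,
        cm7.quadraticTwist (NumberField.discr K : ℚ) = C • cm7.quadraticTwist (n : ℚ) := by
  have h4 : ¬ (4 : ℤ) ∣ n := fun h4 ↦ by
    have h22 : (2 : ℤ) * 2 ∣ n := by rwa [show (2 : ℤ) * 2 = 4 by norm_num]
    have hu := Int.isUnit_iff.mp (hsq 2 h22)
    omega
  by_cases h1 : n % 4 = 1
  · obtain ⟨K, _, _, h2, hdK⟩ :=
      QuadraticFields.Quadratic.exists_numberField_discr_eq (D := n) (Or.inl ⟨h1, hsq, by omega⟩)
    exact ⟨K, inferInstance, inferInstance,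
      isImaginaryQuadratic_iff_discr_neg.mpr ⟨h2, by rw [hdK]; exact hneg⟩, Or.inl hdK,
      1, by rw [hdK, one_smul]⟩
  · have hres : n % 4 = 2 ∨ n % 4 = 3 := by omega
    obtain ⟨K, _, _, h2, hdK⟩ :=
      QuadraticFields.Quadratic.exists_numberField_discr_eq (D := 4 * n)
        (Or.inr ⟨dvd_mul_right 4 n, by rw [show 4 * n / 4 = n by omega]; exact hres,
          by rw [show 4 * n / 4 = n by omega]; exact hsq⟩)
    exact ⟨K, inferInstance, inferInstance,
      isImaginaryQuadratic_iff_discr_neg.mpr ⟨h2, by rw [hdK]; omega⟩, Or.inr hdK,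
      ⟨(Units.mk0 (2 : ℚ) two_ne_zero)⁻¹, 0, 0, 0⟩, by rw [hdK]; exact quadraticTwist_cm7_four_mul n⟩

/-! ## §2 The parent crux K12₂′ ⟺ the `K`-level `2`-converse for `X₀(49)` over ALL imaginary quadratic `K` -/

/-- **K12₂′ from the all-discriminant leaf.** For `W/ℚ` with `j ∈ {−3375, 16581375}` and
`corank Sel_{2^∞} = 1`: pass to a globally minimal isogenous `W'` with `j = −3375` (file 13,
`modelReduction_rankOneTwoConverse`), `W' ≅ E₀^{(n)}` (`n` squarefree), flip to `n < 0` in the isogeny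
class, `K = ℚ(√n)`; `corank Sel_{2^∞}(E₀/K) = 0 + 1`; the leaf gives `ord L(E₀/K) = 1 = 0 + ord L(W)`.
[cite: CoatesLiTianZhai2015, Thm. 1.2 (p. 359, case r = 0)]
[cite: Dokchitser2013ParityNotes, §4 (first display)] [cite: SilvermanAEC2009, X.5 Prop. 5.4 and Cor. 5.4.1] -/
theorem rankOneTwoConverseCMSevenAtAnyTwo_of_kLevelAllDiscr (hmod : hasEntireLFunction_rat)
    (h12 : CoatesLiTianZhai2015.thm12_fullBSD_twist)
    (hX : ∀ (K : Type) [Field K] [NumberField K], IsImaginaryQuadratic K →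
      (cm7.baseChange K).selmerCorank 2 = 1 → analyticRankEK cm7 K = 1) :
    Summit.BirchSwinnertonDyer.BirchSwinnertonDyer.Theses.GoldfeldAllTwistsTwoConverse.RankOneTwoConverseCMSevenAtAnyTwo := by
  intro W _ hj hsel
  obtain ⟨W', hE', hmin', hj', hsel', har⟩ := modelReduction_rankOneTwoConverse W hj hsel
  haveI := hE'
  haveI := hmin'
  rw [← har]
  -- `W' ≅ E₀^{(n)}`, `n` squarefree; a negative representative `n' ∼ n`
  obtain ⟨n, C, hsq, hC⟩ := exists_squarefree_smul_eq_quadraticTwist_cm7 W' hj'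
  obtain ⟨n', hsq', hneg, -, hiso⟩ := exists_neg_squarefree_isIsogenous_quadraticTwist_cm7 hsq
  haveI := cm7.isElliptic_quadraticTwist (Int.cast_ne_zero.mpr hsq.ne_zero : (n : ℚ) ≠ 0)
  haveI := cm7.isElliptic_quadraticTwist (Int.cast_ne_zero.mpr hsq'.ne_zero : (n' : ℚ) ≠ 0)
  -- `K = ℚ(√n')`, `E₀^{(d_K)} ≅ E₀^{(n')}`
  obtain ⟨K, _, _, hK, -, C₂, hC₂⟩ := exists_imaginaryQuadratic_quadraticTwist_cm7_eq_smul hsq' hneg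
  haveI : (cm7.quadraticTwist (NumberField.discr K : ℚ)).IsElliptic := by rw [hC₂]; infer_instance
  have hWdK : IsIsogenous W' (cm7.quadraticTwist (NumberField.discr K : ℚ)) := by
    rw [hC₂]
    exact ((isIsogenous_of_smul_eq hC).trans' hiso).trans' (isIsogenous_smul _ _)
  -- corank over `K`, the leaf, Artin formalism
  have hselK : (cm7.baseChange K).selmerCorank 2 = 1 := by
    rw [selmerCorank_cm7_baseChange h12 K hK.1, ← hWdK.selmerCorank_eq 2, hsel']
  have hEK := hX K hK hselK
  rw [analyticRankEK_cm7 hmod h12 K, ← analyticRank_eq_of_isIsogenous' hWdK] at hEK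
  exact hEK

/-- **The all-discriminant leaf from K12₂′** (the crux is model-free, so no minimal model and no
reduction type is needed): `E₀^{(d_K)}` is an elliptic curve with `j = −3375` and
`corank Sel_{2^∞}(E₀^{(d_K)}) = corank Sel_{2^∞}(E₀/K) = 1`; K12₂′ gives `ord L(E₀^{(d_K)}) = 1`, hence
`ord L(E₀/K) = 0 + 1`. [cite: CoatesLiTianZhai2015, Thm. 1.2 (p. 359, case r = 0)]
[cite: Dokchitser2013ParityNotes, §4 (first display)] [cite: GrossZagier1986, I.§7] -/
theorem kLevelAllDiscr_of_rankOneTwoConverseCMSevenAtAnyTwo (hmod : hasEntireLFunction_rat)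
    (h12 : CoatesLiTianZhai2015.thm12_fullBSD_twist)
    (hK12 : Summit.BirchSwinnertonDyer.BirchSwinnertonDyer.Theses.GoldfeldAllTwistsTwoConverse.RankOneTwoConverseCMSevenAtAnyTwo) :
    ∀ (K : Type) [Field K] [NumberField K], IsImaginaryQuadratic K →
      (cm7.baseChange K).selmerCorank 2 = 1 → analyticRankEK cm7 K = 1 := by
  intro K _ _ hK hselK
  have hd : (NumberField.discr K : ℚ) ≠ 0 := by exact_mod_cast NumberField.discr_ne_zero K
  haveI := cm7.isElliptic_quadraticTwist hd
  have hj : (cm7.quadraticTwist (NumberField.discr K : ℚ)).j = -3375 := by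
    rw [cm7.j_quadraticTwist hd, j_cm7]
  have hsel : (cm7.quadraticTwist (NumberField.discr K : ℚ)).selmerCorank 2 = 1 := by
    rw [← selmerCorank_cm7_baseChange h12 K hK.1, hselK]
  rw [analyticRankEK_cm7 hmod h12 K]
  exact hK12 _ (Or.inl hj) hsel

/-- **K12₂′ ⟺ the `K`-level `2`-converse for `X₀(49)` over all imaginary quadratic fields**, granted
analytic continuation and Coates–Li–Tian–Zhai Thm. 1.2 at `R = 1`.
[cite: BurungaleCastellaSkinnerTian2022, Thm. A (p. 326) and Rem. D (p. 327)]
[cite: CoatesLiTianZhai2015, Thm. 1.2 (p. 359, case r = 0)] -/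
theorem rankOneTwoConverseCMSevenAtAnyTwo_iff_kLevelAllDiscr (hmod : hasEntireLFunction_rat)
    (h12 : CoatesLiTianZhai2015.thm12_fullBSD_twist) :
    Summit.BirchSwinnertonDyer.BirchSwinnertonDyer.Theses.GoldfeldAllTwistsTwoConverse.RankOneTwoConverseCMSevenAtAnyTwo ↔
      ∀ (K : Type) [Field K] [NumberField K], IsImaginaryQuadratic K →
        (cm7.baseChange K).selmerCorank 2 = 1 → analyticRankEK cm7 K = 1 :=
  ⟨kLevelAllDiscr_of_rankOneTwoConverseCMSevenAtAnyTwo hmod h12,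
    rankOneTwoConverseCMSevenAtAnyTwo_of_kLevelAllDiscr hmod h12⟩

/-! ## §3 The good cell ⟺ the leaf over ODD discriminants (`2` unramified in `K`) -/

/-- **The good cell from the odd-discriminant leaf.** For `W` minimal, `j = −3375`, GOOD at `2`, corank
`1`: `W ≅ E₀^{(n)}` with `n ≡ 1 (mod 4)` (otherwise `W` is not good at `2`: Barrios et al., file 1), a
negative `n' ≡ n (mod 4)` in the isogeny class, `K = ℚ(√n')` of ODD discriminant `n'`; then as in §2.
[cite: BarriosEtAl2025, Thm. 5.1 (rows R = I₀)] [cite: CoatesLiTianZhai2015, Thm. 1.2 (case r = 0)]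
[cite: Dokchitser2013ParityNotes, §4 (first display)] -/
theorem goodCell_of_kLevelOddDiscr (hmod : hasEntireLFunction_rat)
    (h12 : CoatesLiTianZhai2015.thm12_fullBSD_twist)
    (hX : ∀ (K : Type) [Field K] [NumberField K], IsImaginaryQuadratic K → Odd (NumberField.discr K) →
      (cm7.baseChange K).selmerCorank 2 = 1 → analyticRankEK cm7 K = 1) :
    ∀ (W : WeierstrassCurve ℚ) [W.IsElliptic] [W.IsGloballyMinimal], W.j = -3375 →
      W.HasGoodReductionAtPrime 2 → W.selmerCorank 2 = 1 → W.analyticRank = 1 := by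
  intro W _ _ hj hgood hsel
  obtain ⟨n, C, hsq, hC⟩ := exists_squarefree_smul_eq_quadraticTwist_cm7 W hj
  -- `n ≡ 1 (mod 4)`, else `W` would not be good at `2`
  have hn1 : n % 4 = 1 := by
    by_contra hn1
    have h4 : ¬ (4 : ℤ) ∣ n := fun h4 ↦ by
      have h22 : (2 : ℤ) * 2 ∣ n := by rwa [show (2 : ℤ) * 2 = 4 by norm_num]
      have hu := Int.isUnit_iff.mp (hsq 2 h22)
      omega
    exact not_hasGoodReductionAtPrime_two_of_smul_eq_quadraticTwist cm7 W
      hasGoodReductionAtPrime_cm7_two (by omega) hC hgood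
  obtain ⟨n', hsq', hneg, hmod4, hiso⟩ := exists_neg_squarefree_isIsogenous_quadraticTwist_cm7 hsq
  haveI := cm7.isElliptic_quadraticTwist (Int.cast_ne_zero.mpr hsq.ne_zero : (n : ℚ) ≠ 0)
  haveI := cm7.isElliptic_quadraticTwist (Int.cast_ne_zero.mpr hsq'.ne_zero : (n' : ℚ) ≠ 0)
  -- `K = ℚ(√n')` has discriminant `n'` (odd)
  obtain ⟨K, _, _, h2, hdK⟩ :=
    QuadraticFields.Quadratic.exists_numberField_discr_eq (D := n') (Or.inl ⟨by omega, hsq', by omega⟩)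
  have hK : IsImaginaryQuadratic K := isImaginaryQuadratic_iff_discr_neg.mpr ⟨h2, by rw [hdK]; exact hneg⟩
  have hodd : Odd (NumberField.discr K) := Int.odd_iff.mpr (by rw [hdK]; omega)
  have hWdK : IsIsogenous W (cm7.quadraticTwist (NumberField.discr K : ℚ)) := by
    rw [hdK]; exact (isIsogenous_of_smul_eq hC).trans' hiso
  haveI : (cm7.quadraticTwist (NumberField.discr K : ℚ)).IsElliptic := by rw [hdK]; infer_instance
  have hselK : (cm7.baseChange K).selmerCorank 2 = 1 := by
    rw [selmerCorank_cm7_baseChange h12 K h2, ← hWdK.selmerCorank_eq 2, hsel]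
  have hEK := hX K hK hodd hselK
  rw [analyticRankEK_cm7 hmod h12 K, ← analyticRank_eq_of_isIsogenous' hWdK] at hEK
  exact hEK

/-- **The odd-discriminant leaf from the good cell.** For imaginary quadratic `K` with `d_K` odd
(`d_K = m ≡ 1 (mod 4)` squarefree), a globally minimal model `W'` of `E₀^{(m)}` (Silverman VIII.8.3) has
`j = −3375`, GOOD reduction at `2` (twisting character unramified at `2`, tree theorem of
`GoldfeldGoodTwistsLocalTwo`) and corank `1`; the good cell gives `ord L(W') = 1 = ord L(E₀/K) - 0`.
[cite: SilvermanAEC2009, VIII.8 Cor. 8.3 and VII.5 Prop. 5.1(a)] [cite: CoatesLiTianZhai2015, Thm. 1.2 (case r = 0)] -/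
theorem kLevelOddDiscr_of_goodCell (hmod : hasEntireLFunction_rat)
    (h12 : CoatesLiTianZhai2015.thm12_fullBSD_twist)
    (hL : ∀ (W : WeierstrassCurve ℚ) [W.IsElliptic] [W.IsGloballyMinimal], W.j = -3375 →
      W.HasGoodReductionAtPrime 2 → W.selmerCorank 2 = 1 → W.analyticRank = 1) :
    ∀ (K : Type) [Field K] [NumberField K], IsImaginaryQuadratic K → Odd (NumberField.discr K) →
      (cm7.baseChange K).selmerCorank 2 = 1 → analyticRankEK cm7 K = 1 := by
  intro K _ _ hK hodd hselK
  -- `d_K = m ≡ 1 (mod 4)` squarefree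
  have hm : NumberField.discr K % 4 = 1 ∧ Squarefree (NumberField.discr K) := by
    rcases QuadraticFields.Quadratic.isFundamentalDiscriminant_discr hK.1 with ⟨h1, hsq, -⟩ | ⟨h4, -, -⟩
    · exact ⟨h1, hsq⟩
    · exfalso
      obtain ⟨k, hk⟩ := h4
      obtain ⟨r, hr⟩ := hodd
      omega
  set m : ℤ := NumberField.discr K with hm_def
  have hm0 : m ≠ 0 := hm.2.ne_zero
  have hmQ : (m : ℚ) ≠ 0 := Int.cast_ne_zero.mpr hm0
  haveI := cm7.isElliptic_quadraticTwist hmQ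
  -- a globally minimal model `W'` of `E₀^{(m)}`: `j = −3375`, good at `2`, corank `1`
  obtain ⟨C', hmin⟩ := hasGlobalMinimalModel_rat_holds (cm7.quadraticTwist (m : ℚ))
  haveI := hmin
  have hC' : C'⁻¹ • (C' • cm7.quadraticTwist (m : ℚ)) = cm7.quadraticTwist (m : ℚ) := inv_smul_smul _ _
  obtain ⟨hj, -, -⟩ := minimalModel_quadraticTwist_cm7 hm0 (C' • cm7.quadraticTwist (m : ℚ)) C'⁻¹ hC'
  have hgood : (C' • cm7.quadraticTwist (m : ℚ)).HasGoodReductionAtPrime 2 :=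
    (hasGoodReductionAtPrime_and_frobeniusTrace_of_smul_eq_quadraticTwist_two cm7 _ hm.1 hC' 2 rfl
      hasGoodReductionAtPrime_cm7_two).1
  have hiso : IsIsogenous (C' • cm7.quadraticTwist (m : ℚ)) (cm7.quadraticTwist (m : ℚ)) :=
    isIsogenous_of_smul _ _
  have hsel' : (C' • cm7.quadraticTwist (m : ℚ)).selmerCorank 2 = 1 := by
    rw [hiso.selmerCorank_eq 2, ← selmerCorank_cm7_baseChange h12 K hK.1, hselK]
  have har : (C' • cm7.quadraticTwist (m : ℚ)).analyticRank = 1 := hL _ hj hgood hsel'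
  rw [analyticRankEK_cm7 hmod h12 K, ← analyticRank_eq_of_isIsogenous' hiso, har]

/-- **Good cell ⟺ odd-discriminant leaf**, granted analytic continuation and CLTZ Thm. 1.2 at `R = 1`:
what Burungale–Castella–Skinner–Tian Thm. A at `p = 2` asserts for the `ℚ(√−7)`-curves is, in
`K`-level currency, the `2`-converse for `X₀(49)` over the imaginary quadratic `K` with `2` UNRAMIFIED.
[cite: BurungaleCastellaSkinnerTian2022, Thm. A (p. 326) and Rem. D (p. 327)]
[cite: CoatesLiTianZhai2015, Thm. 1.2 (p. 359, case r = 0)] -/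
theorem goodCell_iff_kLevelOddDiscr (hmod : hasEntireLFunction_rat)
    (h12 : CoatesLiTianZhai2015.thm12_fullBSD_twist) :
    (∀ (W : WeierstrassCurve ℚ) [W.IsElliptic] [W.IsGloballyMinimal], W.j = -3375 →
        W.HasGoodReductionAtPrime 2 → W.selmerCorank 2 = 1 → W.analyticRank = 1) ↔
      ∀ (K : Type) [Field K] [NumberField K], IsImaginaryQuadratic K → Odd (NumberField.discr K) →
        (cm7.baseChange K).selmerCorank 2 = 1 → analyticRankEK cm7 K = 1 :=
  ⟨kLevelOddDiscr_of_goodCell hmod h12, goodCell_of_kLevelOddDiscr hmod h12⟩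

/-! ## §4 All discriminants = odd ∧ even; the parent from BCST Thm. A and the even leaf -/

/-- The all-discriminant leaf is the conjunction of its odd part and its even part
(`X049KLevelTwoConverseEvenDiscr`, file 1): a fundamental discriminant is `≡ 1 (mod 4)` or divisible
by `4`. [cite: SilvermanAEC2009, X.5 (context)] -/
theorem kLevelAllDiscr_iff_oddDiscr_and_evenDiscr :
    (∀ (K : Type) [Field K] [NumberField K], IsImaginaryQuadratic K →
        (cm7.baseChange K).selmerCorank 2 = 1 → analyticRankEK cm7 K = 1) ↔
      (∀ (K : Type) [Field K] [NumberField K], IsImaginaryQuadratic K → Odd (NumberField.discr K) →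
          (cm7.baseChange K).selmerCorank 2 = 1 → analyticRankEK cm7 K = 1) ∧
        X049KLevelTwoConverseEvenDiscr := by
  refine ⟨fun h ↦ ⟨fun K _ _ hK _ hsel ↦ h K hK hsel, fun K _ _ hK _ hsel ↦ h K hK hsel⟩,
    fun ⟨hodd, heven⟩ K _ _ hK hsel ↦ ?_⟩
  rcases QuadraticFields.Quadratic.isFundamentalDiscriminant_discr hK.1 with ⟨h1, -, -⟩ | ⟨h4, -, -⟩
  · exact hodd K hK (Int.odd_iff.mpr (by omega)) hsel
  · exact heven K hK h4 hsel

/-- **BCST Thm. A ⟹ the odd-discriminant leaf** (through file 13's good cell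
`rankOneTwoConverse_goodCell_of_thmA`). [cite: BurungaleCastellaSkinnerTian2022, Thm. A (p. 326)]
[cite: CoatesLiTianZhai2015, Thm. 1.2 (p. 359, case r = 0)] -/
theorem kLevelOddDiscr_of_thmA (hmod : hasEntireLFunction_rat)
    (h12 : CoatesLiTianZhai2015.thm12_fullBSD_twist)
    (hA : BurungaleCastellaSkinnerTian2022.thmA_analyticRank_eq_one_of_selmerCorank_eq_one) :
    ∀ (K : Type) [Field K] [NumberField K], IsImaginaryQuadratic K → Odd (NumberField.discr K) →
      (cm7.baseChange K).selmerCorank 2 = 1 → analyticRankEK cm7 K = 1 :=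
  kLevelOddDiscr_of_goodCell hmod h12 (rankOneTwoConverse_goodCell_of_thmA hA)

/-- **Granted BCST Thm. A (item 20045's fact), the parent crux K12₂′ ⟺ the EVEN-discriminant leaf**
`X049KLevelTwoConverseEvenDiscr` of file 1 — the `K`-level form of "K12₂′ ⟺ K12₂″ modulo print"
(file 13's `rankOneTwoConverseCMSevenAtAnyTwo_iff_additiveCell`), with no reduction-type hypothesis left.
[cite: BurungaleCastellaSkinnerTian2022, Thm. A (p. 326) and Rem. D (p. 327)]
[cite: CoatesLiTianZhai2015, Thm. 1.2 (p. 359, case r = 0)] -/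
theorem rankOneTwoConverseCMSevenAtAnyTwo_iff_kLevelEvenDiscr_of_thmA (hmod : hasEntireLFunction_rat)
    (h12 : CoatesLiTianZhai2015.thm12_fullBSD_twist)
    (hA : BurungaleCastellaSkinnerTian2022.thmA_analyticRank_eq_one_of_selmerCorank_eq_one) :
    Summit.BirchSwinnertonDyer.BirchSwinnertonDyer.Theses.GoldfeldAllTwistsTwoConverse.RankOneTwoConverseCMSevenAtAnyTwo ↔
      X049KLevelTwoConverseEvenDiscr := by
  rw [rankOneTwoConverseCMSevenAtAnyTwo_iff_kLevelAllDiscr hmod h12, kLevelAllDiscr_iff_oddDiscr_and_evenDiscr]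
  exact ⟨fun h ↦ h.2, fun h ↦ ⟨kLevelOddDiscr_of_thmA hmod h12 hA, h⟩⟩

/-! ## §5 The rung leaf S1⁺ from the even-discriminant leaf (appended) -/

/-- **S1⁺ from the even-discriminant leaf.** The rung leaf `GoldfeldAllTwistsX049` (Goldfeld
`1/2, 1/2, 0` over ALL squarefree twists of `X₀(49)` and, for `100 %` of them, `ord_{s=1} L = rank`,
`Ш` finite, `BSD(W', 2)`) follows from: Coates–Li–Tian–Zhai Thm. 1.2 at `R = 1` (`h12`), BCST Thm. A
(`hA`, route item 20045), the EVEN-discriminant `K`-level leaf for `X₀(49)` (`hX`, OPEN), the formula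
twin (`hL`, route item 19350) and the route's published facts (`hF`, item 19351; its last conjunct is
the analytic continuation used here) — file 12's bridge `goldfeldAllTwistsX049_of_inputs` precomposed
with `rankOneTwoConverseCMSevenAtAnyTwo_iff_kLevelEvenDiscr_of_thmA`.
[cite: BurungaleCastellaSkinnerTian2022, Thm. A and Rem. D] [cite: CoatesLiTianZhai2015, Thm. 1.2 (case r = 0)]
[cite: arXiv250317619, Thm. 1.1 (through the route's facts)] -/
theorem goldfeldAllTwistsX049_of_kLevelEvenDiscr
    (h12 : CoatesLiTianZhai2015.thm12_fullBSD_twist)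
    (hA : BurungaleCastellaSkinnerTian2022.thmA_analyticRank_eq_one_of_selmerCorank_eq_one)
    (hX : X049KLevelTwoConverseEvenDiscr)
    (hL : Summit.BirchSwinnertonDyer.BirchSwinnertonDyer.Theses.GoldfeldAllTwistsTwoConverse.BSDTwoCMSplitRankOne)
    (hF : Summit.BirchSwinnertonDyer.BirchSwinnertonDyer.Theses.GoldfeldAllTwistsTwoConverse.PublishedFactsAllTwists) :
    GoldfeldAllTwistsX049 :=
  goldfeldAllTwistsX049_of_inputs
    ((rankOneTwoConverseCMSevenAtAnyTwo_iff_kLevelEvenDiscr_of_thmA hF.2.2.2.2 h12 hA).2 hX)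
    hL hF.1 hF.2.1 hF.2.2.1 hF.2.2.2.1 hF.2.2.2.2

end Summit.BirchSwinnertonDyer.BirchSwinnertonDyer.Theorems.GoldfeldGoodTwists

end
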